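import Mathlib
import HarnessLib
import Summits.HubbardSuperconductivity.HubbardSuperconductivity.Theorems.KLProgrammeKLRegimeSplitFlatCutoffSymbol

/-!
# Route `KLProgramme`, crux K3 — ENGINE child (gen 3 `KLRegimeEngineV11` stmt-…-19823 / gen 4 stmt-…-19855), two-leg stubs: the
# DE-INTERPOLATED G-EXTENSION `q ↦ mean f + χ_flat(q)·(f(θ(q̃)) − mean f)` (p2 g6's (R-I) carrier `klFrameExtFn`, token for token)
# has EXPLICIT, VOLUME-FREE derivative bounds of EVERY order at EVERY momentum

Cell gate-hubbard-kl, seat hubbard-kl-k3c3-p1 (g2; row «δμ-flow with `klAngularMean` constant piece»).  Third file of the symbol-side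
G-extension regularity layer (`…SplitPolarAngleDerivBounds` → `…SplitFrameExtSymbolBounds` → `…SplitFlatCutoffSymbol` → this).  Plan g11's
Δ23 ruling (HOME STATUS 2026-08-27T00:30Z) adopts (R-I) «de-interpolate the G-extension»: the frame emitted by child 2 becomes the FUNCTION
`klFrameExtFn μ f = p ↦ mean f + klFlatCutoffFn μ p · (f(polarAngle (centredRep p)) − mean f)` (HOME/p2-g6/KLProgrammeKLRegimeSplitFrameFn.draft.lean),
and the two-leg sizes (E3a-G)/(E3a-MS) and `FrameOKFn` (ii) are stated on `onM` of such functions.  Their certification from the engine's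
ANGULAR data is then exactly the statement proved here, for the same lambda (`freeBandFn ≡ sqDispersion`, `centredRep p i = toIocMod
two_pi_pos (−π) (p i)`, `klFlatCutoffFn μ p = 1 − χ₂((ε p − μ)²/(4·klFlatR²))` — so it is `onM (klFrameExtFn μ f)` by `rfl` once that
module lands; stated def-free here so it does not wait for it):

* §1 `eventually_toIocMod_eq_sub` (**centring is locally a translation**: `toIocMod hp a y = y − (toIocDiv hp a x)·p` near every `x`
  with `toIocMod hp a x ≠ a + p`), `sqDispersion_nonneg_of_coord_eq_pi` (a centred coordinate at `π` forces `ε ≥ 0` — impossible on the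
  tube of `klWindowC`), `sqDispersion_centred` / `sqDispersion_sub_zsmul_two_pi` (periodicity of the free band);
* §2 **`norm_iteratedFDeriv_frameExtFn_le`**: for `μ ∈ klWindowC`, `f` `C^N` and `2π`-periodic, `‖Dⁱ(f − m)‖ ≤ G` (`i ≤ n`) and
  `‖Dˡχ₂‖ ≤ X` (`l ≤ n`), at EVERY `q : Momentum`
  `‖Dⁿ (q ↦ m + (1 − χ₂((ε(q)−μ)²/(4·klFlatR²)))·(f(θ(q̃)) − m))(q)‖ ≤ [n=0]·|m| + (n!)²·(2·n!·X·200ⁿ)·G·(4 + max 1 (5(n−1)!/8))ⁿ`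
  — off the tube the function is locally the constant `m`; on the tube `ε(q) < 0`, no centred coordinate is at the cell boundary,
  centring is the translation by `2π·toIocDiv`, and the bound is `…SplitFlatCutoffSymbol`'s at the translated point.

HOW THE ENGINE USES IT ((E3a-Fn) at scale `n`, order `j`): with `f = ν_n(K)` (resp. the increment `ν_n − ν_{n−1}`) and `m = klAngularMean f`,
the angular sizes `‖Dⁱ(f − m)‖ ≤ G_n` come from (E3g)-type data (p1b's `twoLegAngularG_of_moments` / k3c3-p3's curve bounds); the
right-hand side is LINEAR in `G_n` with a `j`-dependent numeral, so `G_n ∝ |U|·Λ_n²·Λ_n^{−i}` reproduces `twoLegBar j n`'s `4^{(j−2)n}`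
law, and NOTHING depends on the volume `(L, M)`.  The only non-numeral constant is `X ≥ sup_{l ≤ j} ‖Dˡχ₂‖` (Salmhofer's
`χ₂ = smoothTransition((4x−1)/3)`).  Proofs only (no definitions); nothing is asserted about the model.
-/

noncomputable section

namespace Summit.HubbardSuperconductivity.HubbardSuperconductivity.Theorems.KLRegimeSplit

set_option linter.dupNamespace false -- summit = problem name (single-conjunct summit), D-0017

open Real Finset Filter Literature.MathematicalPhysics.QuantumLattice
open scoped Topology

/-! ## §1 Centring into `(−π, π]` is a translation near every point off the cell boundary -/

/-- **`toIocMod` is locally a translation** away from the right endpoint: if `toIocMod hp a x ≠ a + p` then near `x`,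
`toIocMod hp a y = y − (toIocDiv hp a x)·p`. -/
theorem eventually_toIocMod_eq_sub {p : ℝ} (hp : 0 < p) (a : ℝ) {x : ℝ} (hx : toIocMod hp a x ≠ a + p) :
    ∀ᶠ y in 𝓝 x, toIocMod hp a y = y - toIocDiv hp a x • p := by
  set n := toIocDiv hp a x with hn
  have hmem : x - n • p ∈ Set.Ioc a (a + p) := sub_toIocDiv_zsmul_mem_Ioc hp a x
  have hne : x - n • p ≠ a + p := by
    intro h; apply hx; rw [toIocMod, ← hn, h]
  have hIoo : x - n • p ∈ Set.Ioo a (a + p) := ⟨hmem.1, lt_of_le_of_ne hmem.2 hne⟩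
  have hcont : Continuous fun y : ℝ => y - n • p := continuous_id.sub continuous_const
  filter_upwards [hcont.continuousAt.preimage_mem_nhds (isOpen_Ioo.mem_nhds hIoo)] with y hy
  have hy' : y - n • p ∈ Set.Ioc a (a + p) := Set.Ioo_subset_Ioc_self hy
  rw [toIocMod, toIocDiv_eq_of_sub_zsmul_mem_Ioc hp hy']

/-- A centred coordinate equal to `π` forces the free band to be nonnegative: `ε(p̃) ≥ 0` if some `p̃ᵢ = π`. -/
theorem sqDispersion_nonneg_of_coord_eq_pi {p : Fin 2 → ℝ} {i : Fin 2} (h : p i = Real.pi) : 0 ≤ sqDispersion p := by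
  unfold sqDispersion
  have h0 := Real.cos_le_one (p 0)
  have h1 := Real.cos_le_one (p 1)
  have hc : Real.cos (p i) = -1 := by rw [h, Real.cos_pi]
  fin_cases i
  · have hc0 : Real.cos (p 0) = -1 := hc
    linarith
  · have hc1 : Real.cos (p 1) = -1 := hc
    linarith

/-- The free band is `2π`-periodic coordinatewise: centring does not change it. -/
theorem sqDispersion_centred (p : Fin 2 → ℝ) :
    sqDispersion (fun i => toIocMod Real.two_pi_pos (-Real.pi) (p i)) = sqDispersion p := by
  have h : ∀ i, Real.cos (toIocMod Real.two_pi_pos (-Real.pi) (p i)) = Real.cos (p i) := by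
    intro i
    rw [toIocMod, show p i - toIocDiv Real.two_pi_pos (-Real.pi) (p i) • (2 * Real.pi) =
        p i + ((-toIocDiv Real.two_pi_pos (-Real.pi) (p i) : ℤ) : ℝ) * (2 * Real.pi) by push_cast; ring]
    exact Real.cos_add_int_mul_two_pi _ _
  simp only [sqDispersion, h]

/-- The free band is invariant under translation by `2π`-multiples. -/
theorem sqDispersion_sub_zsmul_two_pi (p : Fin 2 → ℝ) (z : Fin 2 → ℤ) :
    sqDispersion (fun i => p i - (z i : ℝ) * (2 * Real.pi)) = sqDispersion p := by
  have h : ∀ i, Real.cos (p i - (z i : ℝ) * (2 * Real.pi)) = Real.cos (p i) := by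
    intro i
    rw [show p i - (z i : ℝ) * (2 * Real.pi) = p i + ((-z i : ℤ) : ℝ) * (2 * Real.pi) by push_cast; ring]
    exact Real.cos_add_int_mul_two_pi _ _
  simp only [sqDispersion, h]

/-! ## §2 The de-interpolated G-extension: global explicit bounds at every order -/

section Main

variable {f : ℝ → ℝ} {N : WithTop ℕ∞}

/-- **THE DE-INTERPOLATED G-EXTENSION HAS EXPLICIT, VOLUME-FREE BOUNDS OF EVERY ORDER.**  For `μ ∈ klWindowC`, a `C^N`, `2π`-periodic
angular profile `f`, a constant `m` (the constant piece; `m = klAngularMean f` for `klFrameExtG`/`klFrameExtFn`) with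
`‖Dⁱ(f − m)‖ ≤ G` (`i ≤ n`), and `X` bounding `‖Dˡχ₂‖` (`l ≤ n`), the function
`q ↦ m + (1 − χ₂((ε(q)−μ)²/(4·klFlatR²)))·(f(θ(q̃)) − m)` (`q̃` the centred representative, `θ = polarAngle`; this is p2's
`onM (klFrameExtFn μ f)` token for token) satisfies at EVERY momentum
`‖Dⁿ‖ ≤ [n = 0]·|m| + (n!)²·(2·n!·X·200ⁿ)·G·(4 + max 1 (5(n−1)!/8))ⁿ`. -/
theorem norm_iteratedFDeriv_frameExtFn_le (hf : ContDiff ℝ N f) (hper : Function.Periodic f (2 * Real.pi)) {n : ℕ}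
    (hn : (n : WithTop ℕ∞) ≤ N) {m G X μ : ℝ} (hμ : μ ∈ klWindowC)
    (hG : ∀ i ≤ n, ∀ t : ℝ, ‖iteratedFDeriv ℝ i (fun t => f t - m) t‖ ≤ G)
    (hX : ∀ l ≤ n, ∀ x : ℝ, ‖iteratedFDeriv ℝ l salmhoferCutoff x‖ ≤ X) (q : Momentum) :
    ‖iteratedFDeriv ℝ n (fun q : Momentum =>
        m + (1 - salmhoferCutoff ((sqDispersion (WithLp.ofLp q) - μ) ^ 2 / (4 * klFlatR ^ 2))) *
          (f (polarAngle (fun i => toIocMod Real.two_pi_pos (-Real.pi) (WithLp.ofLp q i))) - m)) q‖ ≤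
      (if n = 0 then |m| else 0) +
        (n.factorial : ℝ) ^ 2 * (2 * n.factorial * X * 200 ^ n) * G * (4 + max 1 (((n - 1).factorial : ℝ) / (8 / 5))) ^ n := by
  have hμ' := hμ
  simp only [klWindowC, Set.mem_Icc] at hμ'
  -- the mean-free profile
  set g : ℝ → ℝ := fun t => f t - m with hg
  have hgc : ContDiff ℝ N g := hf.sub contDiff_const
  have hgp : Function.Periodic g (2 * Real.pi) := fun t => by simp [hg, hper t]
  -- the bound for the product symbol `S₀ = ψ_μ(ε)·g(θ)` at any point
  have hS₀ := fun q' : Momentum => norm_iteratedFDeriv_flatSymbol_le hgc hgp hn hμ hG hX q'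
  set B : ℝ := (n.factorial : ℝ) ^ 2 * (2 * n.factorial * X * 200 ^ n) * G * (4 + max 1 (((n - 1).factorial : ℝ) / (8 / 5))) ^ n
    with hB
  have hB0 : 0 ≤ B := le_trans (norm_nonneg _) (hS₀ q)
  -- rewrite the cutoff argument
  have hfun : (fun q : Momentum =>
        m + (1 - salmhoferCutoff ((sqDispersion (WithLp.ofLp q) - μ) ^ 2 / (4 * klFlatR ^ 2))) *
          (f (polarAngle (fun i => toIocMod Real.two_pi_pos (-Real.pi) (WithLp.ofLp q i))) - m)) =
      fun q : Momentum => m + (1 - salmhoferCutoff (100 * (sqDispersion (WithLp.ofLp q) - μ) ^ 2)) *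
          g (polarAngle (fun i => toIocMod Real.two_pi_pos (-Real.pi) (WithLp.ofLp q i))) := by
    funext q'; rw [div_four_klFlatR_sq]
  rw [hfun]
  by_cases hW : 1 / 10 < |sqDispersion (WithLp.ofLp q) - μ|
  · -- off the tube: the function is locally the constant `m`
    have hopen : IsOpen {q' : Momentum | 1 / 10 < |sqDispersion (WithLp.ofLp q') - μ|} :=
      isOpen_lt continuous_const ((contDiff_sqDispersion_ofLp (N := 0)).continuous.sub continuous_const).abs
    have hev : (fun q : Momentum => m + (1 - salmhoferCutoff (100 * (sqDispersion (WithLp.ofLp q) - μ) ^ 2)) *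
          g (polarAngle (fun i => toIocMod Real.two_pi_pos (-Real.pi) (WithLp.ofLp q i)))) =ᶠ[𝓝 q]
        fun _ => m := by
      filter_upwards [hopen.mem_nhds hW] with q' hq'
      rw [flatProfile_eq_zero_of_le hq'.le, zero_mul, add_zero]
    rw [(hev.iteratedFDeriv ℝ n).eq_of_nhds]
    rcases Nat.eq_zero_or_pos n with rfl | hpos
    · simp only [iteratedFDeriv_zero_eq_comp, Function.comp_apply, LinearIsometryEquiv.norm_map, Real.norm_eq_abs,
        if_true]
      linarith
    · rw [iteratedFDeriv_const_of_ne (by omega), Pi.zero_apply, norm_zero, if_neg (by omega), zero_add]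
      exact hB0
  · -- on the tube: `ε(q) < 0`, so no centred coordinate sits at `π` and centring is a translation near `q`
    have hεle : sqDispersion (WithLp.ofLp q) - μ ≤ 1 / 10 := (abs_le.mp (not_lt.mp hW)).2
    have hεge : -(1 / 10) ≤ sqDispersion (WithLp.ofLp q) - μ := (abs_le.mp (not_lt.mp hW)).1
    have hεneg : sqDispersion (WithLp.ofLp q) < 0 := by linarith
    have hne : ∀ i : Fin 2, toIocMod Real.two_pi_pos (-Real.pi) (WithLp.ofLp q i) ≠ -Real.pi + 2 * Real.pi := by
      intro i h
      have h' : toIocMod Real.two_pi_pos (-Real.pi) (WithLp.ofLp q i) = Real.pi := by rw [h]; ring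
      have hnn := sqDispersion_nonneg_of_coord_eq_pi (p := fun j => toIocMod Real.two_pi_pos (-Real.pi) (WithLp.ofLp q j))
        (i := i) h'
      rw [sqDispersion_centred] at hnn
      linarith
    -- the translation vector
    set z : Fin 2 → ℤ := fun i => toIocDiv Real.two_pi_pos (-Real.pi) (WithLp.ofLp q i) with hz
    set c : Momentum := WithLp.toLp 2 fun i => (z i : ℝ) * (2 * Real.pi) with hc
    have hev1 : ∀ i : Fin 2, ∀ᶠ q' : Momentum in 𝓝 q,
        toIocMod Real.two_pi_pos (-Real.pi) (WithLp.ofLp q' i) = WithLp.ofLp q' i - (z i : ℝ) * (2 * Real.pi) := by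
      intro i
      have hcont : ContinuousAt (fun q' : Momentum => WithLp.ofLp q' i) q :=
        ((continuous_apply i).comp (PiLp.continuous_ofLp 2 _)).continuousAt
      have h := eventually_toIocMod_eq_sub Real.two_pi_pos (-Real.pi) (hne i)
      have h2 := hcont.eventually h
      filter_upwards [h2] with q' hq'
      rw [hq', zsmul_eq_mul]
    have hevall : ∀ᶠ q' : Momentum in 𝓝 q, ∀ i : Fin 2,
        toIocMod Real.two_pi_pos (-Real.pi) (WithLp.ofLp q' i) = WithLp.ofLp q' i - (z i : ℝ) * (2 * Real.pi) :=
      Filter.eventually_all.mpr hev1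
    -- the product symbol and its translate
    set S₀ : Momentum → ℝ := fun q' => (1 - salmhoferCutoff (100 * (sqDispersion (WithLp.ofLp q') - μ) ^ 2)) *
      g (polarAngle (WithLp.ofLp q')) with hS₀def
    have hev : (fun q : Momentum => m + (1 - salmhoferCutoff (100 * (sqDispersion (WithLp.ofLp q) - μ) ^ 2)) *
          g (polarAngle (fun i => toIocMod Real.two_pi_pos (-Real.pi) (WithLp.ofLp q i)))) =ᶠ[𝓝 q]
        fun q' => m + S₀ (q' - c) := by
      filter_upwards [hevall] with q' hq'
      have hcen : (fun i => toIocMod Real.two_pi_pos (-Real.pi) (WithLp.ofLp q' i)) = WithLp.ofLp (q' - c) := by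
        funext i; rw [hq' i, WithLp.ofLp_sub, Pi.sub_apply, hc, WithLp.ofLp_toLp]
      rw [hS₀def]
      simp only
      rw [hcen, WithLp.ofLp_sub, hc, WithLp.ofLp_toLp]
      congr 2
      rw [show (WithLp.ofLp q' - fun i => (z i : ℝ) * (2 * Real.pi)) = fun i => WithLp.ofLp q' i - (z i : ℝ) * (2 * Real.pi)
        from rfl, sqDispersion_sub_zsmul_two_pi]
    rw [(hev.iteratedFDeriv ℝ n).eq_of_nhds]
    -- smoothness of `S₀` at the (nonzero) translated point
    have hq0 : q - c ≠ 0 := by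
      intro h0
      have hq' := hevall.self_of_nhds
      have hzero : (fun i => toIocMod Real.two_pi_pos (-Real.pi) (WithLp.ofLp q i)) = 0 := by
        funext i; rw [hq' i]
        have := congrArg (fun v : Momentum => WithLp.ofLp v i) h0
        simpa [hc] using this
      have h4 : sqDispersion (fun i => toIocMod Real.two_pi_pos (-Real.pi) (WithLp.ofLp q i)) = -4 := by
        rw [hzero]; simp [sqDispersion]; norm_num
      rw [sqDispersion_centred] at h4
      linarith
    have hS₀c : ContDiffAt ℝ (n : WithTop ℕ∞) S₀ (q - c) := by
      have h1 : ContDiffAt ℝ (n : WithTop ℕ∞) (fun q' : Momentum =>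
          1 - salmhoferCutoff (100 * (sqDispersion (WithLp.ofLp q') - μ) ^ 2)) (q - c) := by
        have hψ : ContDiff ℝ (n : WithTop ℕ∞) (fun u : ℝ => 1 - salmhoferCutoff (100 * (u - μ) ^ 2)) := by
          have h := contDiff_flatProfile μ (n := (n : ℕ∞)); exact_mod_cast h
        exact (hψ.comp contDiff_sqDispersion_ofLp).contDiffAt
      exact h1.mul (contDiffAt_comp_polarAngle_ofLp (hgc.of_le hn) hgp hq0)
    have hshift : ContDiffAt ℝ (n : WithTop ℕ∞) (fun q' : Momentum => S₀ (q' - c)) q := by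
      have : ContDiffAt ℝ (n : WithTop ℕ∞) S₀ ((fun q' : Momentum => q' - c) q) := hS₀c
      exact this.comp q (contDiff_id.sub contDiff_const).contDiffAt
    have hconst : ContDiffAt ℝ (n : WithTop ℕ∞) (fun _ : Momentum => m) q := contDiffAt_const
    rw [show (fun q' : Momentum => m + S₀ (q' - c)) = (fun _ : Momentum => m) + fun q' => S₀ (q' - c) from rfl,
      iteratedFDeriv_add_apply hconst hshift, iteratedFDeriv_comp_sub]
    refine (norm_add_le _ _).trans (add_le_add ?_ (hS₀ (q - c)))
    rcases Nat.eq_zero_or_pos n with rfl | hpos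
    · simp only [iteratedFDeriv_zero_eq_comp, Function.comp_apply, LinearIsometryEquiv.norm_map, Real.norm_eq_abs, if_true]
      exact le_rfl
    · rw [iteratedFDeriv_const_of_ne (by omega), Pi.zero_apply, norm_zero, if_neg (by omega)]

end Main

end Summit.HubbardSuperconductivity.HubbardSuperconductivity.Theorems.KLRegimeSplit

end
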